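import Summits.Ventures.YMGap.Census.TwistCensusGerm
import HarnessLib

/-!
# Venture YMGap, track (b) census — flat sheets: the contributing sets of the germ coefficient ARE the flat `(i, j)`-sheets

HONEST FRAMING: venture file of the cell `pub-ymgap` (QuantumFields programme), track (b).  Exact combinatorial
statements about plaquette sets of a rectangular torus `L₀ × ⋯ × L_{d−1}` (any `d`, every side `≥ 1`) and the Haar
moments of `Census/TwistCensusObjects.lean`; nothing about root locations, limits or physics.

`Census/TwistCensusGerm.lean` (engine-1) proves the vanishing half of the germ law (G) of the typed census conjecture
and reduces its coefficient half to `sheetMomentSum = L_ρ`, naming the mechanism («the contributing `S` are exactly the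
`L_ρ` flat sheets, each with `2^P I(sheet) = 1`; that identification and that integral are NOT proved here»).  This file
(1 of 3: `TwistCensusSheets` → `TwistCensusSheetIntegral` → `TwistCensusGermLaw`) proves the IDENTIFICATION, for every
rectangular torus and every plane `(i, j)`, `P := LᵢLⱼ`, `𝒱 := rectVortexSheet Ls i j`:

* `sheetSite`, `sheetLine`, `sheetPlaqChar` (row data, used by `TwistCensusSheetIntegral`); `flatSheet y` — the `P`
  plaquettes `(y + a eᵢ + b eⱼ; i, j)`, `a ∈ ℤ/Lᵢ`, `b ∈ ℤ/Lⱼ` (a flat `(i, j)` 2-torus); `card_flatSheet`;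
  `flatSheet_inter_rectVortexSheet` (the sheet through `q ∈ 𝒱` meets `𝒱` exactly in `q`).
* `eq_flatSheet_of_even` / `eq_flatSheet_of_rectCharMoment_ne_zero`: a mod-2 cycle `S` (a plaquette set meeting every
  link coboundary evenly — e.g. any `S` with `I(S) ≠ 0`, by the support rule of `TwistCensusSupport`) with `|S| = P`
  and `|S ∩ 𝒱|` odd IS a flat sheet.  Mechanism: by parity transport (`TwistCensusGerm.odd_inter_stackAt_iff_of_even`)
  `S` meets each of the `P` parallel stacks, so `S` lies in the `(i, j)` plane (`subset_planePlaquettes_of_odd`); the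
  coboundary of the single `j`-link at `x + eᵢ` meets the plane in exactly the two plaquettes at `x` and `x + eᵢ`, so
  evenness closes `S` under `x ↦ x + eᵢ` (`shift_left_mem_of_mem`), likewise `x ↦ x + eⱼ`; hence `S ⊇` the flat sheet
  through any of its points, with equality by cardinality.
* `sheetMomentSum_eq_sum_rectVortexSheet`: `sheetMomentSum = Σ_{q ∈ 𝒱} 2^P I(flatSheet q)` (the other summands vanish).

References: E. T. Tomboulis, arXiv:0707.2179 §6.2, p. 18: «The minimal cluster of this type consists of a single polymer which
is a 2-dimensional plane Π: x_μ = const., μ = 3, …, d … of size A = L₁L₂, and activity z(Π) = Σ_{half-int. j} c̃_j^A …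
There are ∏_{κ≠1,2} L_κ such minimal clusters giving the leading contribution» [cite: Tomboulis2007Confinement, §6.2 p. 18];
HOME/STRUCTURE.md §4 N-3; HOME/engine/census/TwistCensusParity/ (evidence: (G) 127/127 rows).
-/

noncomputable section

open MeasureTheory Finset Real Function
open scoped BigOperators
open Literature.MathematicalPhysics.QuantumLattice
open Literature.MathematicalPhysics.QuantumFieldTheory
open Literature.MathematicalPhysics.QuantumFieldTheory.Tomboulis2007

namespace Summit.Ventures.YMGap.Census

variable {d : ℕ} (Ls : Fin d → ℕ) [∀ i, NeZero (Ls i)]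

/-! ### Sheet coordinates (definition with the plane directions explicit) -/

/-- The base point of the flat-sheet plaquette at in-plane position `(a, b)` over `y`: `y + a eᵢ + b eⱼ`. -/
def sheetSite (i j : Fin d) (y : RectTorusSite Ls) (a : ZMod (Ls i)) (b : ZMod (Ls j)) : RectTorusSite Ls :=
  y + Pi.single i a + Pi.single j b

/-- The ordered product `h(0,b) h(1,b) ⋯ h(R−1,b)` of the first `R` `i`-links of row `b` of the sheet over `y`
(`R = Lᵢ`: the `i`-Polyakov line `H_b` of the row). -/
def sheetLine (i j : Fin d) (y : RectTorusSite Ls) (b : ZMod (Ls j)) (R : ℕ) (V : RectGaugeConfig Ls SU2) : SU2 :=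
  ((List.range R).map fun a : ℕ => V (sheetSite Ls i j y (a : ZMod (Ls i)) b, i)).prod

/-- The fundamental character of the sheet plaquette at `(a, b)` written in its four links:
`χ(h(a,b) · v(a+1,b) · h(a,b+1)⁻¹ · v(a,b)⁻¹)`, `h = i`-links, `v = j`-links. -/
def sheetPlaqChar (i j : Fin d) (y : RectTorusSite Ls) (a : ZMod (Ls i)) (b : ZMod (Ls j))
    (V : RectGaugeConfig Ls SU2) : ℝ :=
  su2Char 1 (V (sheetSite Ls i j y a b, i) * V (sheetSite Ls i j y (a + 1) b, j) *
    (V (sheetSite Ls i j y a (b + 1), i))⁻¹ * (V (sheetSite Ls i j y a b, j))⁻¹)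

variable {i j : Fin d} (hij : i < j)

/-! ### Flat sheets -/

omit [∀ i, NeZero (Ls i)] in
/-- The `i`-coordinate of a sheet site. -/
theorem sheetSite_apply_left (hij : i < j) (y : RectTorusSite Ls) (a : ZMod (Ls i)) (b : ZMod (Ls j)) :
    sheetSite Ls i j y a b i = y i + a := by
  simp [sheetSite, Pi.single_eq_of_ne hij.ne]

omit [∀ i, NeZero (Ls i)] in
/-- The `j`-coordinate of a sheet site. -/
theorem sheetSite_apply_right (hij : i < j) (y : RectTorusSite Ls) (a : ZMod (Ls i)) (b : ZMod (Ls j)) :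
    sheetSite Ls i j y a b j = y j + b := by
  simp [sheetSite, Pi.single_eq_of_ne hij.ne']

omit [∀ i, NeZero (Ls i)] in
/-- The transverse coordinates of a sheet site are those of `y`. -/
theorem sheetSite_apply_of_ne (y : RectTorusSite Ls) (a : ZMod (Ls i)) (b : ZMod (Ls j)) {k : Fin d} (hki : k ≠ i)
    (hkj : k ≠ j) : sheetSite Ls i j y a b k = y k := by
  simp [sheetSite, Pi.single_eq_of_ne hki, Pi.single_eq_of_ne hkj]

omit [∀ i, NeZero (Ls i)] in
/-- Moving one step along `eᵢ` inside the sheet. -/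
theorem sheetSite_add_single_left (y : RectTorusSite Ls) (a : ZMod (Ls i)) (b : ZMod (Ls j)) :
    sheetSite Ls i j y a b + Pi.single i 1 = sheetSite Ls i j y (a + 1) b := by
  simp only [sheetSite, Pi.single_add]
  abel

omit [∀ i, NeZero (Ls i)] in
/-- Moving one step along `eⱼ` inside the sheet. -/
theorem sheetSite_add_single_right (y : RectTorusSite Ls) (a : ZMod (Ls i)) (b : ZMod (Ls j)) :
    sheetSite Ls i j y a b + Pi.single j 1 = sheetSite Ls i j y a (b + 1) := by
  simp only [sheetSite, Pi.single_add]
  abel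

omit [∀ i, NeZero (Ls i)] in
/-- The sheet site at `(0, 0)` is `y`. -/
theorem sheetSite_zero_zero (y : RectTorusSite Ls) : sheetSite Ls i j y (0 : ZMod (Ls i)) (0 : ZMod (Ls j)) = y := by
  simp [sheetSite]

omit [∀ i, NeZero (Ls i)] in
/-- Sheet coordinates are coordinates. -/
theorem sheetSite_eq_iff (hij : i < j) (y : RectTorusSite Ls) {a a' : ZMod (Ls i)} {b b' : ZMod (Ls j)} :
    sheetSite Ls i j y a b = sheetSite Ls i j y a' b' ↔ a = a' ∧ b = b' := by
  constructor
  · intro h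
    refine ⟨?_, ?_⟩
    · have := congrFun h i
      rwa [sheetSite_apply_left Ls hij, sheetSite_apply_left Ls hij, add_right_inj] at this
    · have := congrFun h j
      rwa [sheetSite_apply_right Ls hij, sheetSite_apply_right Ls hij, add_right_inj] at this
  · rintro ⟨rfl, rfl⟩
    rfl

/-- **The flat `(i, j)`-sheet through `y`**: all `(i, j)`-plaquettes whose base point agrees with `y` off the coordinates
`i, j` — a flat 2-torus of `LᵢLⱼ` plaquettes wrapping the `i` and `j` cycles (Tomboulis's minimal polymer `Π`).
[cite: Tomboulis2007Confinement, §6.2 (the minimal polymers Π after the activity z(Y)), p. 18] -/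
def flatSheet (y : RectTorusSite Ls) : Finset (RectPlaquette Ls) :=
  univ.filter fun p => p.2 = ⟨(i, j), hij⟩ ∧ ∀ k, k ≠ i → k ≠ j → p.1 k = y k

/-- Membership in a flat sheet. -/
theorem mem_flatSheet (y : RectTorusSite Ls) (p : RectPlaquette Ls) :
    p ∈ flatSheet Ls hij y ↔ p.2 = ⟨(i, j), hij⟩ ∧ ∀ k, k ≠ i → k ≠ j → p.1 k = y k := by
  simp [flatSheet]

/-- The sheet plaquette at `(a, b)` lies on the sheet. -/
theorem sheetPlaq_mem_flatSheet (y : RectTorusSite Ls) (a : ZMod (Ls i)) (b : ZMod (Ls j)) :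
    (sheetSite Ls i j y a b, ⟨(i, j), hij⟩) ∈ flatSheet Ls hij y :=
  (mem_flatSheet Ls hij y _).2 ⟨rfl, fun _ hki hkj => sheetSite_apply_of_ne Ls y a b hki hkj⟩

/-- The flat sheet is parametrised by its in-plane coordinates. -/
theorem flatSheet_eq_image (y : RectTorusSite Ls) :
    flatSheet Ls hij y = (univ : Finset (ZMod (Ls i) × ZMod (Ls j))).image
      fun ab => ((sheetSite Ls i j y ab.1 ab.2, ⟨(i, j), hij⟩) : RectPlaquette Ls) := by
  ext p
  rw [mem_flatSheet, Finset.mem_image]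
  constructor
  · rintro ⟨h2, hk⟩
    refine ⟨(p.1 i - y i, p.1 j - y j), Finset.mem_univ _, ?_⟩
    rcases p with ⟨z, P⟩
    simp only at h2 hk ⊢
    rw [h2]
    refine Prod.ext ?_ rfl
    funext k
    show sheetSite Ls i j y (z i - y i) (z j - y j) k = z k
    by_cases hki : k = i
    · rw [hki, sheetSite_apply_left Ls hij, add_sub_cancel]
    · by_cases hkj : k = j
      · rw [hkj, sheetSite_apply_right Ls hij, add_sub_cancel]
      · rw [sheetSite_apply_of_ne Ls y _ _ hki hkj, hk k hki hkj]
  · rintro ⟨ab, -, rfl⟩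
    exact ⟨rfl, fun k hki hkj => sheetSite_apply_of_ne Ls y _ _ hki hkj⟩

omit [∀ i, NeZero (Ls i)] in
/-- The parametrisation of the flat sheet is injective. -/
theorem sheetPlaq_injective (y : RectTorusSite Ls) :
    Function.Injective fun ab : ZMod (Ls i) × ZMod (Ls j) =>
      ((sheetSite Ls i j y ab.1 ab.2, ⟨(i, j), hij⟩) : RectPlaquette Ls) := by
  intro ab ab' h
  have h1 := (sheetSite_eq_iff Ls hij y).1 (congrArg Prod.fst h)
  exact Prod.ext h1.1 h1.2

/-- **A flat sheet has `LᵢLⱼ` plaquettes.** -/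
theorem card_flatSheet (y : RectTorusSite Ls) : (flatSheet Ls hij y).card = Ls i * Ls j := by
  rw [flatSheet_eq_image, Finset.card_image_of_injective _ (sheetPlaq_injective Ls hij y), Finset.card_univ,
    Fintype.card_prod, ZMod.card, ZMod.card]

/-- **The flat sheet through a plaquette `q` of the twist stack meets the twist stack exactly in `q`.** -/
theorem flatSheet_inter_rectVortexSheet {q : RectPlaquette Ls} (hq : q ∈ rectVortexSheet Ls i j hij) :
    flatSheet Ls hij q.1 ∩ rectVortexSheet Ls i j hij = {q} := by
  rw [rectVortexSheet_eq_stackAt, mem_stackAt] at hq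
  ext p
  rw [Finset.mem_inter, mem_flatSheet, rectVortexSheet_eq_stackAt, mem_stackAt, Finset.mem_singleton]
  constructor
  · rintro ⟨⟨hp2, hk⟩, -, hpi, hpj⟩
    refine Prod.ext ?_ (hp2.trans hq.1.symm)
    funext k
    by_cases hki : k = i
    · rw [hki, hpi, hq.2.1]
    · by_cases hkj : k = j
      · rw [hkj, hpj, hq.2.2]
      · exact hk k hki hkj
  · rintro rfl
    exact ⟨⟨hq.1, fun k _ _ => rfl⟩, hq.1, hq.2.1, hq.2.2⟩

/-- Distinct plaquettes of the twist stack have distinct flat sheets. -/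
theorem flatSheet_injOn :
    Set.InjOn (fun q : RectPlaquette Ls => flatSheet Ls hij q.1) ↑(rectVortexSheet Ls i j hij) := by
  intro q hq q' hq' h
  have h1 := flatSheet_inter_rectVortexSheet Ls hij (Finset.mem_coe.1 hq)
  have h2 := flatSheet_inter_rectVortexSheet Ls hij (Finset.mem_coe.1 hq')
  have h3 : ({q} : Finset (RectPlaquette Ls)) = {q'} := by
    rw [← h1, ← h2]
    exact congrArg (· ∩ rectVortexSheet Ls i j hij) h
  exact Finset.singleton_injective h3

/-! ### Identification: the contributing sets of the germ coefficient are the flat sheets -/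

omit [∀ i, NeZero (Ls i)] in
/-- Boundary slots of the plane plaquette at `z` in the single `j`-link at `x + eᵢ`: one each for `z = x`, `z = x + eᵢ`. -/
private theorem rectFlipCount_single_jlink (hij : i < j) (x z : RectTorusSite Ls) :
    rectFlipCount ({(x + Pi.single i 1, j)} : Finset (RectEdge Ls)) z i j =
      (if z = x then 1 else 0) + (if z = x + Pi.single i 1 then 1 else 0) := by
  simp only [rectFlipCount, rectLinkInd, Finset.mem_singleton, Prod.mk.injEq, hij.ne, and_false, if_false, zero_add,
    add_zero, and_true, add_left_inj]

omit [∀ i, NeZero (Ls i)] in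
/-- Boundary slots of the plane plaquette at `z` in the single `i`-link at `x + eⱼ`: one each for `z = x + eⱼ`, `z = x`. -/
private theorem rectFlipCount_single_ilink (hij : i < j) (x z : RectTorusSite Ls) :
    rectFlipCount ({(x + Pi.single j 1, i)} : Finset (RectEdge Ls)) z i j =
      (if z = x + Pi.single j 1 then 1 else 0) + (if z = x then 1 else 0) := by
  simp only [rectFlipCount, rectLinkInd, Finset.mem_singleton, Prod.mk.injEq, hij.ne', and_false, if_false, add_zero,
    and_true, add_left_inj]

/-- Members of a plane set are plane plaquettes (plumbing). -/
private theorem snd_eq_of_subset_planePlaquettes {S : Finset (RectPlaquette Ls)} (hplane : S ⊆ planePlaquettes Ls hij)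
    {p : RectPlaquette Ls} (hp : p ∈ S) : p.2 = ⟨(i, j), hij⟩ := by
  have h := hplane hp
  simp only [planePlaquettes, Finset.mem_filter, Finset.mem_univ, true_and] at h
  exact h

/-- **Closure along `eᵢ`**: a plane set meeting every coboundary evenly (a mod-2 cycle; e.g. a contributing set, by the
support rule) that contains the plaquette at `x` contains the plaquette at `x + eᵢ` — evenness against the coboundary of
the single `j`-link at `x + eᵢ`, which meets the plane in exactly these two plaquettes. -/
theorem shift_left_mem_of_mem {S : Finset (RectPlaquette Ls)}
    (hev : ∀ E : Finset (RectEdge Ls), Even (S ∩ rectCoboundary E).card)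
    (hplane : S ⊆ planePlaquettes Ls hij) {x : RectTorusSite Ls} (hx : (x, ⟨(i, j), hij⟩) ∈ S) :
    (x + Pi.single i 1, ⟨(i, j), hij⟩) ∈ S := by
  by_contra hx'
  by_cases hdeg : x + Pi.single i 1 = x
  · rw [hdeg] at hx'
    exact hx' hx
  have heven := hev {(x + Pi.single i 1, j)}
  have hone : S ∩ rectCoboundary ({(x + Pi.single i 1, j)} : Finset (RectEdge Ls)) = {(x, ⟨(i, j), hij⟩)} := by
    ext p
    rw [Finset.mem_inter, mem_rectCoboundary, Finset.mem_singleton]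
    constructor
    · rintro ⟨hpS, hodd⟩
      have hp2 := snd_eq_of_subset_planePlaquettes Ls hij hplane hpS
      rcases p with ⟨z, P⟩
      simp only at hp2
      subst hp2
      simp only [rectFlipCount_single_jlink Ls hij] at hodd
      by_cases hz : z = x
      · rw [hz]
      · exfalso
        by_cases hz' : z = x + Pi.single i 1
        · rw [hz'] at hpS
          exact hx' hpS
        · rw [if_neg hz, if_neg hz'] at hodd
          exact (Nat.not_odd_iff_even.mpr (by decide : Even (0 + 0 : ℕ))) hodd
    · rintro rfl
      refine ⟨hx, ?_⟩
      show Odd (rectFlipCount _ x i j)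
      rw [rectFlipCount_single_jlink Ls hij, if_pos rfl, if_neg (fun h => hdeg h.symm)]
      exact odd_one
  rw [hone, Finset.card_singleton] at heven
  exact Nat.not_even_one heven

/-- **Closure along `eⱼ`** (the same with the single `i`-link at `x + eⱼ`). -/
theorem shift_right_mem_of_mem {S : Finset (RectPlaquette Ls)}
    (hev : ∀ E : Finset (RectEdge Ls), Even (S ∩ rectCoboundary E).card)
    (hplane : S ⊆ planePlaquettes Ls hij) {x : RectTorusSite Ls} (hx : (x, ⟨(i, j), hij⟩) ∈ S) :
    (x + Pi.single j 1, ⟨(i, j), hij⟩) ∈ S := by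
  by_contra hx'
  by_cases hdeg : x + Pi.single j 1 = x
  · rw [hdeg] at hx'
    exact hx' hx
  have heven := hev {(x + Pi.single j 1, i)}
  have hone : S ∩ rectCoboundary ({(x + Pi.single j 1, i)} : Finset (RectEdge Ls)) = {(x, ⟨(i, j), hij⟩)} := by
    ext p
    rw [Finset.mem_inter, mem_rectCoboundary, Finset.mem_singleton]
    constructor
    · rintro ⟨hpS, hodd⟩
      have hp2 := snd_eq_of_subset_planePlaquettes Ls hij hplane hpS
      rcases p with ⟨z, P⟩
      simp only at hp2
      subst hp2
      simp only [rectFlipCount_single_ilink Ls hij] at hodd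
      by_cases hz : z = x
      · rw [hz]
      · exfalso
        by_cases hz' : z = x + Pi.single j 1
        · rw [hz'] at hpS
          exact hx' hpS
        · rw [if_neg hz', if_neg hz] at hodd
          exact (Nat.not_odd_iff_even.mpr (by decide : Even (0 + 0 : ℕ))) hodd
    · rintro rfl
      refine ⟨hx, ?_⟩
      show Odd (rectFlipCount _ x i j)
      rw [rectFlipCount_single_ilink Ls hij, if_pos rfl, if_neg (fun h => hdeg h.symm)]
      exact odd_one
  rw [hone, Finset.card_singleton] at heven
  exact Nat.not_even_one heven

/-- A plane mod-2 cycle containing the plaquette at `x` contains every plaquette of the flat sheet through `x`. -/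
theorem sheetPlaq_mem_of_mem {S : Finset (RectPlaquette Ls)}
    (hev : ∀ E : Finset (RectEdge Ls), Even (S ∩ rectCoboundary E).card)
    (hplane : S ⊆ planePlaquettes Ls hij) {x : RectTorusSite Ls} (hx : (x, ⟨(i, j), hij⟩) ∈ S)
    (a : ZMod (Ls i)) (b : ZMod (Ls j)) : (sheetSite Ls i j x a b, ⟨(i, j), hij⟩) ∈ S := by
  have hnat : ∀ n m : ℕ, (sheetSite Ls i j x (n : ZMod (Ls i)) (m : ZMod (Ls j)), ⟨(i, j), hij⟩) ∈ S := by
    intro n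
    induction n with
    | zero =>
      intro m
      induction m with
      | zero => simpa [sheetSite_zero_zero] using hx
      | succ m ih =>
        have h := shift_right_mem_of_mem Ls hij hev hplane ih
        rwa [sheetSite_add_single_right, ← Nat.cast_succ] at h
    | succ n ih =>
      intro m
      have h := shift_left_mem_of_mem Ls hij hev hplane (ih m)
      rwa [sheetSite_add_single_left, ← Nat.cast_succ] at h
  have h := hnat a.val b.val
  rwa [ZMod.natCast_zmod_val, ZMod.natCast_zmod_val] at h

/-- Hence it contains the flat sheet through `x`. -/
theorem flatSheet_subset_of_mem {S : Finset (RectPlaquette Ls)}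
    (hev : ∀ E : Finset (RectEdge Ls), Even (S ∩ rectCoboundary E).card)
    (hplane : S ⊆ planePlaquettes Ls hij) {x : RectTorusSite Ls} (hx : (x, ⟨(i, j), hij⟩) ∈ S) :
    flatSheet Ls hij x ⊆ S := by
  rw [flatSheet_eq_image]
  intro p hp
  obtain ⟨ab, -, rfl⟩ := Finset.mem_image.1 hp
  exact sheetPlaq_mem_of_mem Ls hij hev hplane hx ab.1 ab.2

/-- **A mod-2 cycle `S` with `|S| = LᵢLⱼ` meeting the twist stack oddly lies in the `(i, j)` plane**: it meets each of
the `LᵢLⱼ` disjoint parallel stacks (parity transport, `TwistCensusGerm.odd_inter_stackAt_iff_of_even`), which already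
accounts for all its plaquettes. -/
theorem subset_planePlaquettes_of_odd {S : Finset (RectPlaquette Ls)} (hcard : S.card = Ls i * Ls j)
    (hodd : Odd (S ∩ rectVortexSheet Ls i j hij).card)
    (hev : ∀ E : Finset (RectEdge Ls), Even (S ∩ rectCoboundary E).card) : S ⊆ planePlaquettes Ls hij := by
  rw [rectVortexSheet_eq_stackAt] at hodd
  have hall : ∀ c : ZMod (Ls i) × ZMod (Ls j), 1 ≤ (S ∩ stackAt Ls hij c.1 c.2).card := fun c =>
    ((odd_inter_stackAt_iff_of_even Ls hij (fun a b => hev _) (fun a b => hev _) c.1 c.2).mpr hodd).pos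
  have hge : S.card ≤ (S ∩ planePlaquettes Ls hij).card := by
    rw [card_inter_planePlaquettes_eq_sum, hcard]
    calc Ls i * Ls j = ∑ _c : ZMod (Ls i) × ZMod (Ls j), 1 := by
          simp [Finset.card_univ, Fintype.card_prod, ZMod.card]
      _ ≤ _ := Finset.sum_le_sum fun c _ => hall c
  exact Finset.inter_eq_left.1 (Finset.eq_of_subset_of_card_le Finset.inter_subset_left hge)

/-- **IDENTIFICATION (combinatorial form).  A mod-2 cycle (a plaquette set meeting every coboundary evenly) with
`|S| = LᵢLⱼ` plaquettes that meets the twist stack `𝒱ᵢⱼ` oddly is a flat `(i, j)`-sheet** — the one through the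
plaquette in which it meets the twist stack. -/
theorem eq_flatSheet_of_even {S : Finset (RectPlaquette Ls)} (hcard : S.card = Ls i * Ls j)
    (hodd : Odd (S ∩ rectVortexSheet Ls i j hij).card)
    (hev : ∀ E : Finset (RectEdge Ls), Even (S ∩ rectCoboundary E).card) :
    ∃ q ∈ rectVortexSheet Ls i j hij, S = flatSheet Ls hij q.1 := by
  have hplane := subset_planePlaquettes_of_odd Ls hij hcard hodd hev
  obtain ⟨q, hq⟩ : (S ∩ rectVortexSheet Ls i j hij).Nonempty := Finset.card_pos.1 hodd.pos
  rw [Finset.mem_inter] at hq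
  refine ⟨q, hq.2, ?_⟩
  have hq2 := snd_eq_of_subset_planePlaquettes Ls hij hplane hq.1
  have hxS : (q.1, ⟨(i, j), hij⟩) ∈ S := by
    rw [← hq2]
    exact hq.1
  exact (Finset.eq_of_subset_of_card_le (flatSheet_subset_of_mem Ls hij hev hplane hxS)
    (by rw [hcard, card_flatSheet])).symm

/-- **IDENTIFICATION.  A plaquette set with `|S| = LᵢLⱼ`, `|S ∩ 𝒱ᵢⱼ|` odd and non-zero Haar moment `I(S) ≠ 0` is a
flat `(i, j)`-sheet** (support rule `TwistCensusSupport.even_inter_rectCoboundary_of_rectCharMoment_ne_zero` +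
`eq_flatSheet_of_even`). [cite: Tomboulis2007Confinement, §6.2 (the minimal polymers Π after the activity z(Y)), p. 18] -/
theorem eq_flatSheet_of_rectCharMoment_ne_zero {S : Finset (RectPlaquette Ls)} (hcard : S.card = Ls i * Ls j)
    (hodd : Odd (S ∩ rectVortexSheet Ls i j hij).card) (hS : rectCharMoment Ls S ≠ 0) :
    ∃ q ∈ rectVortexSheet Ls i j hij, S = flatSheet Ls hij q.1 :=
  eq_flatSheet_of_even Ls hij hcard hodd fun E => even_inter_rectCoboundary_of_rectCharMoment_ne_zero Ls hS E

/-- **The sheet moment sum is the sum over the flat sheets**: `sheetMomentSum = Σ_{q ∈ 𝒱ᵢⱼ} 2^{LᵢLⱼ} I(flatSheet q)`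
(the other summands vanish by the identification; the flat sheets through distinct `q ∈ 𝒱ᵢⱼ` are distinct). -/
theorem sheetMomentSum_eq_sum_rectVortexSheet :
    sheetMomentSum Ls hij =
      ∑ q ∈ rectVortexSheet Ls i j hij, (2 : ℝ) ^ (Ls i * Ls j) * rectCharMoment Ls (flatSheet Ls hij q.1) := by
  unfold sheetMomentSum
  rw [← Finset.sum_image (f := fun S => (2 : ℝ) ^ (Ls i * Ls j) * rectCharMoment Ls S) (flatSheet_injOn Ls hij)]
  symm
  apply Finset.sum_subset
  · intro S hS
    obtain ⟨q, hq, rfl⟩ := Finset.mem_image.1 hS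
    rw [Finset.mem_filter, Finset.mem_powerset]
    refine ⟨Finset.subset_univ _, card_flatSheet Ls hij q.1, ?_⟩
    rw [flatSheet_inter_rectVortexSheet Ls hij hq, Finset.card_singleton]
    exact odd_one
  · intro S hS hS'
    rw [Finset.mem_filter] at hS
    by_contra h
    have hI : rectCharMoment Ls S ≠ 0 := fun h0 => h (by rw [h0, mul_zero])
    obtain ⟨q, hq, rfl⟩ := eq_flatSheet_of_rectCharMoment_ne_zero Ls hij hS.2.1 hS.2.2 hI
    exact hS' (Finset.mem_image.2 ⟨q, hq, rfl⟩)

end Summit.Ventures.YMGap.Census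

end
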